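import Literature.Probability.RandomPlanarGeometry.RestrictionDerivOuter
import HarnessLib

/-!
# Crux `SAWDevelopingMap.ObservableToSLE` (stmt-CriticalPhenomena-10472), line `six-class-type-ladder`,
stub T2b′ `stub_carvedReduction_squeeze`: piece (G6″), OUTER CONTINUITY OF `Φ'_A(0)` ALONG
THICKENINGS **AND BOUNDARY COLLARS**

Landing target:
`Summits/CriticalPhenomena/SAWScalingLimit/Theorems/SAWDevelopingMapObservableToSLETypeLadderCarvedReductionSqueezeCollar.lean`
(`--supports stmt-CriticalPhenomena-10472`; registered sub-goal `stub_carvedReduction_collarDeriv`).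

The INNER Jordan approximant `M'` of the limit carving `M̂` inside the super-domain `E` must stay a
positive distance away from `∂E ∖ (gate balls)` (the pinning translations drift by `o(1) ≫ δ_k`
relative to the fixed domain `D`, so lattice cells of `M'` near `∂D` would leave `D`); in
half-plane coordinates its hull `H ⊇ A` therefore contains, besides a thin thickening of the hull
`A` of `M̂`, a thin COLLAR `{im ≤ θ, r' ≤ |z| ≤ R'}` along the real axis, away from `0` and `∞`.
The tree's outer continuity `HasRestrictionDeriv.exists_forall_outer_ge` covers only
`H ⊆ thickHull A δ`.  Here the same proof ([LSW] §2: chain rule through the quotient hull, which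
`Φ_A` maps into two thin boxes, half-ellipse hulls, union bound) is run with the collar allowed:
on the collar `im Φ_A(z) ≤ im z ≤ θ` by Julia's lemma (`IsRestrictionMap.im_le_im`).

* `stub_carvedReduction_collarDeriv` — for a nonempty `*`-hull `A` with data `(Φ, d)`, `ε > 0`,
  `r' > 0`, `R'`: there are `δ, θ > 0` such that every `*`-hull `H` with
  `A ⊆ H ⊆ thickHull A δ ∪ {z : im z ≤ θ, r' ≤ ‖z‖ ≤ R'}` has `Φ'_H(0) ≥ (1 - ε) Φ'_A(0)`.

Sources: G. F. Lawler, O. Schramm, W. Werner, J. Amer. Math. Soc. 16 (2003) §2 (2.4), p. 8.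
-/

noncomputable section

open Set Filter Metric Bornology Function Complex
open _root_.Topology
open UpperHalfPlane (upperHalfPlaneSet isOpen_upperHalfPlaneSet)
open scoped ComplexConjugate
open Literature.Probability.RandomPlanarGeometry

namespace Summit.CriticalPhenomena.SAWScalingLimit.Theorems.ObservableToSLE.TypeLadder

set_option maxHeartbeats 400000 in
/-- **Registered sub-goal `stub_carvedReduction_collarDeriv`** (crux item stmt-CriticalPhenomena-10472,
stub T2b′ `stub_carvedReduction_squeeze`, piece (G6″) OUTER CONTINUITY WITH COLLARS): for a nonempty
`*`-hull `A` with restriction data `(Φ, d)`, `ε > 0`, an inner radius `r' > 0` and an outer radius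
`R'`, there are `δ > 0` and `θ > 0` such that every `*`-hull `H` with
`A ⊆ H ⊆ thickHull A δ ∪ {z | im z ≤ θ ∧ r' ≤ ‖z‖ ≤ R'}` and every restriction datum `(Ψ, e)` of
`H` satisfy `(1 - ε) d ≤ e`.  (`HasRestrictionDeriv.exists_forall_outer_ge` is the case of an
empty collar.) [cite: LawlerSchrammWerner2003Restriction, §2 (2.4) p. 7 with p. 8 (Semigroups, ±-hulls)] -/
theorem stub_carvedReduction_collarDeriv :
    ∀ (A : Set ℂ) (Φ : ConformalEquiv (upperHalfPlaneSet \ A) upperHalfPlaneSet) (d ε r' R' : ℝ),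
      IsStarHull A → A.Nonempty → IsRestrictionMap A Φ → HasRestrictionDeriv A Φ d → 0 < ε → 0 < r' →
      ∃ δ > 0, ∃ θ > 0, ∀ (H : Set ℂ) (Ψ : ConformalEquiv (upperHalfPlaneSet \ H) upperHalfPlaneSet) (e : ℝ),
        IsStarHull H → A ⊆ H → H ⊆ thickHull A δ ∪ {z : ℂ | z.im ≤ θ ∧ r' ≤ ‖z‖ ∧ ‖z‖ ≤ R'} →
        IsRestrictionMap H Ψ → HasRestrictionDeriv H Ψ e → (1 - ε) * d ≤ e := by
  intro A Φ d ε r' R' hA hne hΦ hd hε hr'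
  classical
  -- the nice map `Φ₀` of `A`
  obtain ⟨Φ₀, hΦ₀, h0, hinf, d₀, hd₀0, -, hd₀⟩ := hA.exists_restrictionMap_tendsto
  have hdd₀ : d = d₀ := hd.unique hA (hd₀.of_isRestrictionMap hA hΦ₀ hΦ)
  subst hdd₀
  -- geometry of the thickened hulls: a radius `r₁` kept free near `0`, an outer radius `R₁`
  obtain ⟨s₀, hs₀, hs₀F⟩ := exists_forall_zero_notMem_thickHull hA
  set δ₀ : ℝ := s₀ / 2 with hδ₀
  have hδ₀0 : 0 < δ₀ := by positivity
  have h0F : (0 : ℂ) ∉ thickHull A δ₀ := hs₀F δ₀ hδ₀0.le (by rw [hδ₀]; linarith)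
  obtain ⟨r₁, hr₁, hr₁F⟩ : ∃ r₁ > 0, ball (0 : ℂ) r₁ ⊆ (thickHull A δ₀)ᶜ :=
    Metric.isOpen_iff.1 (isClosed_thickHull A δ₀).isOpen_compl 0 h0F
  obtain ⟨R₁, hR₁⟩ := (isBounded_hpFill (isBounded_nbhdSet hA.isBoundedHull.1 1) :
    IsBounded (thickHull A 1)).subset_closedBall 0
  -- radii also covering the collar
  set r₂ : ℝ := min r₁ r' with hr₂
  have hr₂0 : 0 < r₂ := lt_min hr₁ hr'
  set R₂ : ℝ := max R₁ R' with hR₂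
  -- bounds for `Φ₀`
  obtain ⟨M, hM0, hM⟩ := hΦ₀.exists_norm_le hA R₂
  obtain ⟨c₀, hc₀, hc₀le⟩ := hΦ₀.exists_le_norm hA hr₂0
  -- the ellipse parameters
  set a : ℝ := c₀ / 4 with ha
  set b : ℝ := max M c₀ + 1 with hb
  have ha0 : 0 < a := by positivity
  have hab : a < b := by
    rw [ha, hb]; linarith [le_max_right M c₀]
  obtain ⟨ρ, hρ0, hρ1, hBρ, hρd⟩ := exists_rho_ellDeriv_gt hab ha0 (half_pos hε)
  have hθ₁ : 0 < ellH a b * (jLevel ρ - 2) := mul_pos (ellH_pos hab) (by linarith [two_lt_jLevel hρ0 hρ1])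
  set θ : ℝ := min (ellH a b * (jLevel ρ - 2) / 2) (c₀ / 4) with hθ
  have hθ0 : 0 < θ := lt_min (by positivity) (by positivity)
  obtain ⟨δ₁, hδ₁, hδ₁im⟩ := hΦ₀.exists_forall_im_lt_of_infDist_le hA hne hθ0
  set δ : ℝ := min δ₁ (min δ₀ 1) with hδ
  have hδ0 : 0 < δ := lt_min hδ₁ (lt_min hδ₀0 one_pos)
  have hδδ₁ : δ ≤ δ₁ := min_le_left _ _
  have hδδ₀ : δ ≤ δ₀ := (min_le_right _ _).trans (min_le_left _ _)
  have hδ1 : δ ≤ 1 := (min_le_right _ _).trans (min_le_right _ _)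
  refine ⟨δ, hδ0, θ, hθ0, fun H Ψ e hH hsub hHF hΨ he ↦ ?_⟩
  -- the quotient hull `Q` and its containment in the two thin boxes
  set Q : Set ℂ := quotientHull H A Φ₀ with hQ
  have hQstar : IsStarHull Q := hH.isStarHull_quotientHull hsub h0 hinf
  set P : Set ℂ := Icc (c₀ / 2) M ×ℂ Icc 0 θ with hP
  set N : Set ℂ := imagAxisRefl '' P with hN
  have hPc : IsClosed P := isClosed_Icc.reProdIm isClosed_Icc
  have hNc : IsClosed N := by rw [hN, imagAxisRefl.isClosed_image]; exact hPc
  have himage : Φ₀ '' ((H \ A) ∩ upperHalfPlaneSet) ⊆ P ∪ N := by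
    rintro _ ⟨z, ⟨⟨hzH, hzA⟩, hz⟩, rfl⟩
    -- `z` is far from `0`, not too far out, and `im Φ₀ z ≤ θ` — in both cases
    have hkey : r₂ ≤ ‖z‖ ∧ ‖z‖ ≤ R₂ ∧ (Φ₀ z).im ≤ θ := by
      rcases hHF hzH with hzF | ⟨hzim, hzr', hzR'⟩
      · refine ⟨?_, ?_, ?_⟩
        · by_contra hlt
          push Not at hlt
          have hlt' : ‖z‖ < r₁ := lt_of_lt_of_le hlt (min_le_left _ _)
          exact hr₁F (mem_ball_zero_iff.2 hlt') (thickHull_mono A hδδ₀ hzF)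
        · have := hR₁ (thickHull_mono A hδ1 hzF)
          rw [mem_closedBall, dist_zero_right] at this
          exact this.trans (le_max_left _ _)
        · exact hΦ₀.im_le_of_mem_thickHull hA hθ0 hδ₁ hδ₁im hδ0.le hδδ₁ ⟨hz, hzA⟩ hzF
      · refine ⟨(min_le_right _ _).trans hzr', hzR'.trans (le_max_right _ _), ?_⟩
        exact (hΦ₀.im_le_im hA.isBoundedHull.1 ⟨hz, hzA⟩).trans hzim
    obtain ⟨hzr, hzR, hw_im⟩ := hkey
    have hw_lo : c₀ ≤ ‖Φ₀ z‖ := hc₀le z ⟨hz, hzA⟩ hzr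
    have hw_hi : ‖Φ₀ z‖ ≤ M := hM z ⟨hz, hzA⟩ hzR
    have hw_im0 : 0 < (Φ₀ z).im := Φ₀.mapsTo ⟨hz, hzA⟩
    have hθc : θ ≤ c₀ / 4 := min_le_right _ _
    -- `|re| ≥ c₀/2` since `‖w‖ ≥ c₀` and `im w ≤ θ ≤ c₀/4`
    have hre : c₀ / 2 ≤ |(Φ₀ z).re| := by
      have h1 : c₀ ^ 2 ≤ (Φ₀ z).re ^ 2 + (Φ₀ z).im ^ 2 := by
        have := Complex.sq_norm (Φ₀ z)
        rw [Complex.normSq_apply] at this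
        nlinarith
      have h2 : (Φ₀ z).im ^ 2 ≤ (c₀ / 4) ^ 2 := by nlinarith
      have h3 : (c₀ / 2) ^ 2 ≤ (Φ₀ z).re ^ 2 := by nlinarith
      nlinarith [sq_abs (Φ₀ z).re, abs_nonneg (Φ₀ z).re]
    have hreM : |(Φ₀ z).re| ≤ M := (abs_re_le_norm _).trans hw_hi
    rcases le_or_gt 0 (Φ₀ z).re with hpos | hneg
    · left
      rw [abs_of_nonneg hpos] at hre hreM
      exact ⟨⟨hre, hreM⟩, hw_im0.le, hw_im⟩
    · right
      rw [abs_of_neg hneg] at hre hreM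
      refine ⟨imagAxisRefl (Φ₀ z), ⟨⟨?_, ?_⟩, ?_, ?_⟩, imagAxisRefl_imagAxisRefl _⟩
      · simpa using hre
      · simpa using hreM
      · simpa using hw_im0.le
      · simpa using hw_im
  have hQPN : Q ⊆ P ∪ N := by
    rw [hQ, quotientHull]
    exact closure_minimal himage (hPc.union hNc)
  -- the two half-ellipse hulls
  have hθe : θ < ellH a b * (jLevel ρ - 2) := lt_of_le_of_lt (min_le_left _ _) (by linarith)
  have hPE : P ⊆ ellHull a b ρ := reProdIm_subset_ellHull hab (by rw [ha]; linarith) (by rw [hb]; linarith [le_max_left M c₀]) hθe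
  have hE : IsStarHull (ellHull a b ρ) := isStarHull_ellHull hab hρ0 hρ1 hBρ
  have hEm : IsStarHull (imagAxisRefl '' ellHull a b ρ) := hE.image_imagAxisRefl
  have hNE : N ⊆ imagAxisRefl '' ellHull a b ρ := image_mono hPE
  have hEre : ∀ w ∈ ellHull a b ρ, 0 < w.re := fun w hw ↦ re_pos_of_mem_ellHull hab hBρ hw
  have hEmre : ∀ w ∈ imagAxisRefl '' ellHull a b ρ, w.re < 0 := by
    rintro _ ⟨w, hw, rfl⟩
    rw [imagAxisRefl_re]
    linarith [hEre w hw]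
  -- the `±`-parts of `Q`
  obtain ⟨hQp, hQm, hQunion, -, -, -⟩ := hQstar.sidePart_decomposition hQstar.isBoundedHull.isConnected_union_im_nonpos
  have hside : ∀ {s : ℝ}, s = 1 ∨ s = -1 → ∀ q ∈ sidePart Q s,
      (s = 1 → q ∈ ellHull a b ρ) ∧ (s = -1 → q ∈ imagAxisRefl '' ellHull a b ρ) := by
    intro s hs q hq
    obtain ⟨C, hCQ, hCconn, hqC, x, hx, hxC⟩ := exists_isPreconnected_of_mem_sidePart hq
    have hCsub : C ⊆ Q := hCQ.trans (sidePart_subset Q s)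
    have hCuv : C ⊆ {w : ℂ | 0 < w.re} ∪ {w : ℂ | w.re < 0} := fun w hw ↦ by
      rcases hQPN (hCsub hw) with h | h
      · exact Or.inl (hEre w (hPE h))
      · exact Or.inr (hEmre w (hNE h))
    have hdisj : Disjoint {w : ℂ | 0 < w.re} {w : ℂ | w.re < 0} :=
      Set.disjoint_left.2 fun w h1 h2 ↦ by simp only [mem_setOf_eq] at h1 h2; linarith
    have ho1 : IsOpen {w : ℂ | 0 < w.re} := isOpen_lt continuous_const continuous_re
    have ho2 : IsOpen {w : ℂ | w.re < 0} := isOpen_lt continuous_re continuous_const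
    constructor
    · intro hs1
      subst hs1
      have hxpos : 0 < x := by simpa using hx
      have hCleft : C ⊆ {w : ℂ | 0 < w.re} :=
        hCconn.subset_left_of_subset_union ho1 ho2 hdisj hCuv ⟨x, hxC, by simpa using hxpos⟩
      rcases hQPN (hCsub hqC) with h | h
      · exact hPE h
      · exact absurd (hCleft hqC) (by simp only [mem_setOf_eq, not_lt]; exact (hEmre q (hNE h)).le)
    · intro hs1
      subst hs1
      have hxneg : x < 0 := by simpa using hx
      have hCright : C ⊆ {w : ℂ | w.re < 0} :=
        hCconn.subset_right_of_subset_union ho1 ho2 hdisj hCuv ⟨x, hxC, by simpa using hxneg⟩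
      rcases hQPN (hCsub hqC) with h | h
      · exact absurd (hCright hqC) (by simp only [mem_setOf_eq, not_lt]; exact (hEre q (hPE h)).le)
      · exact hNE h
  have hQpE : sidePart Q 1 ⊆ ellHull a b ρ := fun q hq ↦ (hside (Or.inl rfl) q hq).1 rfl
  have hQmE : sidePart Q (-1) ⊆ imagAxisRefl '' ellHull a b ρ := fun q hq ↦ (hside (Or.inr rfl) q hq).2 rfl
  -- restriction data everywhere
  obtain ⟨ΨQ, hΨQ, -⟩ := IsStarHull.existsUnique_isRestrictionMap_holds hQstar
  obtain ⟨dQ, -, -, hdQ⟩ := IsStarHull.exists_hasRestrictionDeriv_holds hQstar hΨQ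
  obtain ⟨Ψp, hΨp, -⟩ := IsStarHull.existsUnique_isRestrictionMap_holds hQp.1
  obtain ⟨dp, -, -, hdp⟩ := IsStarHull.exists_hasRestrictionDeriv_holds hQp.1 hΨp
  obtain ⟨Ψm, hΨm, -⟩ := IsStarHull.existsUnique_isRestrictionMap_holds hQm.1
  obtain ⟨dm, -, -, hdm⟩ := IsStarHull.exists_hasRestrictionDeriv_holds hQm.1 hΨm
  have hdataE := hasRestrictionDeriv_ellConf hab hρ0 hρ1 hBρ
  have hmapE := isRestrictionMap_ellConf hab hρ0 hρ1 hBρ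
  obtain ⟨ΨEm, hΨEm, hdEm⟩ := exists_restrictionData_of_image rfl (ellConf hab hρ0 hρ1.le hBρ) hmapE hdataE
  -- the bounds
  have hp : ellDeriv a b ρ ≤ dp := hdataE.le_of_subset hE hQp.1 hQpE hmapE hΨp hdp
  have hm : ellDeriv a b ρ ≤ dm := hdEm.le_of_subset hEm hQm.1 hQmE hΨEm hΨm hdm
  have hunion : 1 - dQ ≤ (1 - dp) + (1 - dm) :=
    HasRestrictionDeriv.one_sub_le_add hQp.1 hQm.1 hQstar hQunion hΨp hΨm hΨQ hdp hdm hdQ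
  have hdQge : 1 - ε ≤ dQ := by linarith
  -- the chain rule `e = dQ * d`
  have hchain : e = dQ * d :=
    he.eq_mul_quotientHull hH hA hsub hΦ₀ h0 hinf hΨ hd₀ hΨQ hdQ
  rw [hchain]
  exact mul_le_mul_of_nonneg_right hdQge hd₀0.le

end Summit.CriticalPhenomena.SAWScalingLimit.Theorems.ObservableToSLE.TypeLadder

end
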